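import Summits.AtomisticToContinuum.Crystallization.Theorems.BrittleRungDescentLadderGroundStatesBinding
import Literature.MathematicalPhysics.StatisticalMechanics.MiePotential
import HarnessLib

/-!
# Route `BrittleRungDescent`, support item `LadderGroundStates` (stmt-AtomisticToContinuum-10945):
# existence of ground states for a general pair potential and on the Mie ladder

Helper file (part 2 of the existence half of `LadderGroundStates`), continuing
`…LadderGroundStatesBinding.lean`: the Blanc–Lewin 2015, §1.2 existence argument for a pair
potential `V` with `V 0 = 0`, bounded below, negative on `(1, ∞)`, tending to `0` at infinity,
continuous on `(0, ∞)` and with a hard core (`V r < M` forces `r ≥ δ(M) > 0`):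

* `exists_level_of_binding` — below the binding level no group of particles escapes;
* `exists_isGroundState_of_lt` — the induction step; `exists_isGroundState` — minimisers exist
  for every `N` (strong induction), in every dimension `d ≥ 1`;
* the Mie rungs `V_q = miePotential q` (`q ≥ 1`) have all the listed properties
  (`miePotential_zero`, `continuousOn_miePotential`, `exists_hardCore_miePotential`), whence
  `exists_isGroundState_miePotential : ∀ N, ∃ x : Fin N → ℝ³, IsGroundState (miePotential q) x`.
-/

noncomputable section

open scoped BigOperators Topology
open Metric Set Filter

namespace Summit.AtomisticToContinuum.Crystallization.Theorems

open Literature.MathematicalPhysics.StatisticalMechanics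

namespace LadderGroundStates

variable {V : ℝ → ℝ} {c : ℝ} {d N : ℕ}

/-- **The binding gap.** If `E(N) < E(K) + E(N-K)` for all `1 ≤ K < N` (`N ≥ 2`) and `V → 0` at
infinity (`V 0 = 0`, `V` bounded below), then there are a threshold `t > 0` and a level
`B' > E(N)` such that every configuration of `N` distinct points in which a non-empty proper group
of particles is farther than `t` from the rest has energy `≥ B'`: with
`B = min_K E(K) + E(N-K)`, `g = B - E(N) > 0`, choose `t ≥ 1` with `V ≥ -g/(2N²)` on `[t, ∞)`
and `B' = B - g/2` (Blanc–Lewin 2015, §1.2, footnote to (6): "if `K` particles escape, then we get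
a contradiction from (6)"). [cite: BlancLewin2015, §1.2 (6)] -/
theorem exists_level_of_binding (h0 : V 0 = 0) (hc : ∀ r, c ≤ V r)
    (hlim : Tendsto V atTop (𝓝 0)) (hN : 2 ≤ N)
    (hbind : ∀ K, 1 ≤ K → K < N → groundStateEnergy V d N <
      groundStateEnergy V d K + groundStateEnergy V d (N - K)) :
    ∃ t B' : ℝ, 0 < t ∧ groundStateEnergy V d N < B' ∧
      ∀ x : Fin N → EuclideanSpace ℝ (Fin d), Function.Injective x →
        ∀ S : Finset (Fin N), S.Nonempty → Sᶜ.Nonempty →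
          (∀ i ∈ S, ∀ k ∈ Sᶜ, t < dist (x i) (x k)) → B' ≤ interactionEnergy V x := by
  set E : ℕ → ℝ := fun K => groundStateEnergy V d K with hE
  -- the binding gap `g = B - E(N) > 0`
  obtain ⟨K₀, hK₀, hK₀min⟩ := Finset.exists_min_image (Finset.Ico 1 N)
    (fun K => E K + E (N - K)) ⟨1, by simp; omega⟩
  rw [Finset.mem_Ico] at hK₀
  have hB : E N < E K₀ + E (N - K₀) := hbind K₀ hK₀.1 hK₀.2
  set g : ℝ := E K₀ + E (N - K₀) - E N with hg_def
  have hg : 0 < g := by simp only [hg_def]; linarith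
  have hN0 : 0 < N := by omega
  have hNpos : (0 : ℝ) < N := by exact_mod_cast hN0
  -- the tail level `ε = g / (2 N²)` and the threshold `t`
  set ε : ℝ := g / (2 * (N : ℝ) ^ 2) with hε_def
  have hε : 0 < ε := by positivity
  have hev : ∀ᶠ s in atTop, -ε ≤ V s := by
    have := hlim.eventually (Ioi_mem_nhds (show -ε < 0 by linarith))
    exact this.mono fun s hs => le_of_lt hs
  obtain ⟨t₀, ht₀⟩ := Filter.eventually_atTop.1 hev
  set t : ℝ := max 1 t₀ with ht_def
  have ht0 : 0 < t := lt_of_lt_of_le one_pos (le_max_left _ _)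
  have htail : ∀ s, t ≤ s → -ε ≤ V s := fun s hs => ht₀ s ((le_max_right _ _).trans hs)
  refine ⟨t, E K₀ + E (N - K₀) - (N : ℝ) ^ 2 * ε, ht0, ?_, ?_⟩
  · show E N < _
    have : (N : ℝ) ^ 2 * ε = g / 2 := by
      simp only [hε_def]
      field_simp
    rw [this]
    linarith
  intro x hx S hS hSc hfar
  have h := le_interactionEnergy_of_far (d := d) h0 hc hx S htail
    fun i hi k hk => (hfar i hi k hk).le
  have hcard : S.card + Sᶜ.card = N := by rw [Finset.card_add_card_compl, Fintype.card_fin]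
  have hS1 : 1 ≤ S.card := Finset.card_pos.2 hS
  have hSc1 : 1 ≤ Sᶜ.card := Finset.card_pos.2 hSc
  have hSN : S.card < N := by omega
  have hmin := hK₀min S.card (by rw [Finset.mem_Ico]; exact ⟨hS1, hSN⟩)
  have hcs : Sᶜ.card = N - S.card := by omega
  rw [hcs] at h
  have hprod : (S.card : ℝ) * ((N - S.card : ℕ) : ℝ) ≤ (N : ℝ) ^ 2 := by
    have a : (S.card : ℝ) ≤ N := by exact_mod_cast hSN.le
    have b : ((N - S.card : ℕ) : ℝ) ≤ N := by exact_mod_cast Nat.sub_le N S.card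
    have a0 : (0 : ℝ) ≤ S.card := Nat.cast_nonneg _
    have b0 : (0 : ℝ) ≤ ((N - S.card : ℕ) : ℝ) := Nat.cast_nonneg _
    nlinarith
  have key := mul_le_mul_of_nonneg_right hprod hε.le
  simp only [hE] at hmin h ⊢
  linarith

/-- **The induction step** (Blanc–Lewin 2015, §1.2 with the footnote to (6)): in dimension
`d ≥ 1`, for a potential `V` with `V 0 = 0`, bounded below, negative on `(1, ∞)`, tending to `0`
at infinity, continuous on `(0, ∞)` and with a hard core, if the problems with fewer than `N`
particles have minimisers, so does the `N`-particle problem: strict binding from the smaller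
minimisers (`groundStateEnergy_add_lt`), no escape below the binding level
(`exists_level_of_binding`, `exists_far_or_forall_dist_le`), a minimal distance from the energy
bound (the hard core), and compactness modulo translations (`exists_isGroundState_of_bounds`).
[cite: BlancLewin2015, §1.2 (6)] -/
theorem exists_isGroundState_of_lt (hd : 0 < d) (h0 : V 0 = 0) (hc : ∀ r, c ≤ V r)
    (hneg : ∀ s, 1 < s → V s < 0) (hlim : Tendsto V atTop (𝓝 0))
    (hcont : ContinuousOn V (Set.Ioi 0))
    (hcore : ∀ M : ℝ, ∃ δ : ℝ, 0 < δ ∧ ∀ r : ℝ, 0 < r → V r < M → δ ≤ r) (N : ℕ)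
    (ih : ∀ K < N, ∃ y : Fin K → EuclideanSpace ℝ (Fin d), IsGroundState V y) :
    ∃ x : Fin N → EuclideanSpace ℝ (Fin d), IsGroundState V x := by
  haveI hne := nonempty_injective_config hd N
  rcases le_or_gt N 1 with hN1 | hN2
  · -- at most one particle: no interaction
    haveI : Subsingleton (Fin N) := Fin.subsingleton_iff_le_one.2 hN1
    refine ⟨fun _ => 0, Function.injective_of_subsingleton _, ?_⟩
    unfold groundStateEnergy
    simp only [interactionEnergy_of_subsingleton, ciInf_const]
  -- `N ≥ 2`
  have hN0 : 0 < N := by omega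
  -- (a) strict binding `E(N) < E(K) + E(N-K)` from the minimisers of the smaller problems
  have hbind : ∀ K, 1 ≤ K → K < N → groundStateEnergy V d N <
      groundStateEnergy V d K + groundStateEnergy V d (N - K) := by
    intro K hK1 hKN
    obtain ⟨y, hy⟩ := ih K hKN
    obtain ⟨z, hz⟩ := ih (N - K) (by omega)
    have := groundStateEnergy_add_lt hd h0 hc hneg hK1 (by omega) hy hz
    rwa [Nat.add_sub_cancel' hKN.le] at this
  -- (b)-(c) the level `B'` below which no group of particles escapes farther than `t`
  obtain ⟨t, B', ht0, hB', hfarE⟩ := exists_level_of_binding h0 hc hlim hN2 hbind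
  -- (c') configurations with energy `< B'` are `t`-chained: diameter `≤ (N-1) t`
  have hnear : ∀ x : Fin N → EuclideanSpace ℝ (Fin d), Function.Injective x →
      interactionEnergy V x < B' → ∀ i k, dist (x i) (x k) ≤ ((N - 1 : ℕ) : ℝ) * t := by
    intro x hx hxE i k
    rcases exists_far_or_forall_dist_le x ht0.le with ⟨S, hS, hSc, hfar⟩ | h
    · exact absurd (hfarE x hx S hS hSc hfar) (not_le.2 hxE)
    · have := h i k
      rwa [Fintype.card_fin] at this
  -- (d) configurations with energy `< B'` are `δ`-separated (hard core)
  set M : ℝ := 2 * B' + (N : ℝ) ^ 2 * |c| with hM_def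
  obtain ⟨δ, hδ0, hδ⟩ := hcore M
  have hsep : ∀ x : Fin N → EuclideanSpace ℝ (Fin d), Function.Injective x →
      interactionEnergy V x < B' → ∀ i k, i ≠ k → δ ≤ dist (x i) (x k) := by
    intro x hx hxE i k hik
    refine hδ _ (dist_pos.2 (hx.ne hik)) ?_
    have := apply_dist_le_two_mul_interactionEnergy h0 hc x i k
    simp only [hM_def]
    linarith
  -- (e) compactness modulo translations
  exact exists_isGroundState_of_bounds hc hcont ⟨0, hN0⟩ hne hB' hδ0 hnear hsep

/-- **Existence of ground states** for a pair potential `V` with `V 0 = 0`, bounded below,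
negative on `(1, ∞)`, tending to `0` at infinity, continuous on `(0, ∞)` and with a hard core, in
every dimension `d ≥ 1` and for every particle number `N` (Blanc–Lewin 2015, §1.2: "when `V` is
continuous on `(0, ∞)` and negative at infinity, then `E(N)` always possesses minimizers"), by
strong induction on `N` via `exists_isGroundState_of_lt`. [cite: BlancLewin2015, §1.2 (6)] -/
theorem exists_isGroundState (hd : 0 < d) (h0 : V 0 = 0) (hc : ∀ r, c ≤ V r)
    (hneg : ∀ s, 1 < s → V s < 0) (hlim : Tendsto V atTop (𝓝 0))
    (hcont : ContinuousOn V (Set.Ioi 0))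
    (hcore : ∀ M : ℝ, ∃ δ : ℝ, 0 < δ ∧ ∀ r : ℝ, 0 < r → V r < M → δ ≤ r) (N : ℕ) :
    ∃ x : Fin N → EuclideanSpace ℝ (Fin d), IsGroundState V x :=
  Nat.strong_induction_on N fun N ih =>
    exists_isGroundState_of_lt hd h0 hc hneg hlim hcont hcore N ih

/-! ## The Mie rungs `V_q = miePotential q` -/

/-- `V_q(0) = 0` with Lean's conventions `0⁻¹ = 0`, `1/0 = 0` (never physically used).
[folklore] -/
theorem miePotential_zero (q : ℕ) : miePotential q 0 = 0 := by
  rcases Nat.eq_zero_or_pos q with rfl | hq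
  · simp [miePotential]
  · simp [miePotential, zero_pow hq.ne', zero_pow (by omega : 2 * q ≠ 0)]

/-- `V_q` is continuous on `(0, ∞)`. [folklore] -/
theorem continuousOn_miePotential (q : ℕ) : ContinuousOn (miePotential q) (Set.Ioi 0) :=
  fun _r hr => ((contDiffAt_miePotential q (n := 0) (ne_of_gt hr)).continuousAt).continuousWithinAt

/-- **Hard core from an energy bound** for the Mie rungs (`q ≥ 1`): if `V_q(r) < M` with `r > 0`
then `r ≥ min 1 (3 + 2q·max(M,0))⁻¹`. Indeed with `u = r^{-q}`, `2q V_q(r) = u(u - 2)`; if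
`r < min 1 U⁻¹` (`U = 3 + 2q max(M,0) ≥ 3`) then `u ≥ r⁻¹ > U`, so `u(u-2) ≥ u > U ≥ 2qM`.
[folklore] -/
theorem exists_hardCore_miePotential {q : ℕ} (hq : 1 ≤ q) (M : ℝ) :
    ∃ δ : ℝ, 0 < δ ∧ ∀ r : ℝ, 0 < r → miePotential q r < M → δ ≤ r := by
  set U : ℝ := 3 + 2 * (q : ℝ) * max M 0 with hU_def
  have hm0 : 0 ≤ max M 0 := le_max_right _ _
  have hMle : M ≤ max M 0 := le_max_left _ _
  have hq0 : (0 : ℝ) < q := by exact_mod_cast hq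
  have hq1 : (1 : ℝ) ≤ q := by exact_mod_cast hq
  have hU3 : 3 ≤ U := by
    have : 0 ≤ 2 * (q : ℝ) * max M 0 := by positivity
    linarith
  have hU0 : 0 < U := by linarith
  refine ⟨min 1 U⁻¹, lt_min one_pos (inv_pos.2 hU0), fun r hr h => ?_⟩
  by_contra hlt
  rw [not_le] at hlt
  have hr1 : r < 1 := hlt.trans_le (min_le_left _ _)
  have hrU : r < U⁻¹ := hlt.trans_le (min_le_right _ _)
  -- `u = r⁻¹ ^ q > U`
  have hinv1 : 1 < r⁻¹ := (one_lt_inv₀ hr).2 hr1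
  have hinvU : U < r⁻¹ := by rwa [lt_inv_comm₀ hU0 hr]
  set u : ℝ := r⁻¹ ^ q with hu_def
  have hu : U < u := by
    calc U < r⁻¹ := hinvU
      _ = r⁻¹ ^ 1 := (pow_one _).symm
      _ ≤ r⁻¹ ^ q := pow_le_pow_right₀ hinv1.le hq
  have hu3 : 3 < u := lt_of_le_of_lt hU3 hu
  -- `2q V_q(r) = u² - 2u ≥ u > U ≥ 2 q M`
  have hV : miePotential q r = 1 / (2 * (q : ℝ)) * u ^ 2 - 1 / (q : ℝ) * u := by
    rw [miePotential_apply, hu_def, pow_mul']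
  have hkey : (q : ℝ) * M ≤ (q : ℝ) * max M 0 := mul_le_mul_of_nonneg_left hMle hq0.le
  have h2 : 2 * (q : ℝ) * M < u ^ 2 - 2 * u := by nlinarith
  have h3 : M < miePotential q r := by
    rw [hV]
    have : 1 / (2 * (q : ℝ)) * u ^ 2 - 1 / (q : ℝ) * u = (u ^ 2 - 2 * u) / (2 * (q : ℝ)) := by
      field_simp
    rw [this, lt_div_iff₀ (by positivity)]
    linarith
  exact absurd h (not_lt.2 h3.le)

/-- **Ground states exist on every rung of the Mie ladder**: for `q ≥ 1` and every `N`, the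
`N`-particle energy for `V_q = miePotential q` in `ℝ³` is minimised by a configuration of
distinct points (Blanc–Lewin 2015, §1.2: `V_q` is continuous on `(0, ∞)`, stable, `→ +∞` at
`0⁺`, negative beyond `1` and `→ 0` at infinity; `exists_isGroundState`).
[cite: BlancLewin2015, §1.2 (6)] -/
theorem exists_isGroundState_miePotential {q : ℕ} (hq : 1 ≤ q) (N : ℕ) :
    ∃ x : Fin N → EuclideanSpace ℝ (Fin 3), IsGroundState (miePotential q) x :=
  have hq' : q ≠ 0 := by omega
  exists_isGroundState (by norm_num) (miePotential_zero q) (neg_one_div_le_miePotential hq')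
    (fun _ hs => miePotential_neg hq' hs) (tendsto_miePotential_atTop hq')
    (continuousOn_miePotential q) (exists_hardCore_miePotential hq) N

end LadderGroundStates

end Summit.AtomisticToContinuum.Crystallization.Theorems

end
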